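import Literature.Analysis.InnerProduct.SecularExcessMulti

/-!
# Multi-driver secular excess, RAYLEIGH form: `λ_min(A)·(r − 1) ≤ ε ≤ ‖A‖·(r − 1)`

Topic `Literature/Analysis/InnerProduct` (companion of `SecularExcessMulti`). Setting as there: `A` a
symmetric operator with nonnegative form on a real inner product space, drivers `v : ι → E`,
downdate `Q = A − ∑ᵢ |vᵢ⟩⟨vᵢ|`, witnesses `A zⱼ = vⱼ`, an eigenpair `A u − ∑ᵢ ⟪vᵢ,u⟫ vᵢ = −ε u` with
MOMENT VECTOR `cᵢ := ⟪vᵢ,u⟫`, `|c|² := ∑ᵢ cᵢ²`, capacitance matrix `M = (⟪vᵢ,zⱼ⟫) = VᵀA⁻¹V`, EXCESS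
form `Ex(c) := ∑ᵢ∑ⱼ cᵢcⱼ⟪vᵢ,zⱼ⟫ − ∑ᵢ cᵢ² = cᵀ(M − I)c = (r − 1)|c|²` where `r := cᵀMc/|c|²` is the
RAYLEIGH QUOTIENT of the capacitance matrix at the moment vector. `SecularExcessMulti` proved
`Ex(c) = ε⟪u, Zc⟫`, `ε‖u‖² ≤ Ex(c) ≤ ε‖Zc‖²` and `|c|² = ⟪Au,u⟫ + ε‖u‖²`. This file adds the three
bounds that make the `m`-driver law the exact analogue of the one-driver law of `SecularExcess`
(`(s − 1)λ_min(A) ≤ ε ≤ (s − 1)‖A‖`, `ε ≤ (s − 1)⟪Au,u⟫/‖u‖²`; for one driver `r = s = vᵀA⁻¹v`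
whatever `c` is), dimension-free, the `zⱼ` as hypotheses, no inverses and no spectral theorem:

* `finiteRank_downdate_eig_mul_sq_moment_le_excess_mul_form` — for ANY eigenpair (no sign
  condition) `ε ‖u‖² |c|² ≤ Ex(c) ⟪A u, u⟫`, i.e. `ε ≤ (r − 1)⟪Au,u⟫/‖u‖²`
  (PSD Cauchy–Schwarz `⟪A d, u⟫² ≤ ⟪A d, d⟫⟪A u, u⟫` for `d = Zc − u`, `A d = ε u`);
* `finiteRank_downdate_eig_mul_sq_moment_le_mul_excess` — `⟪Ax,x⟫ ≤ Λ‖x‖²` for all `x`, `0 ≤ ε`,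
  `u ≠ 0` ⇒ `ε |c|² ≤ Λ Ex(c)` (`ε ≤ ‖A‖(r − 1)`);
* `finiteRank_downdate_mul_excess_le_eig_mul_sq_moment` — `0 ≤ β`, `β‖x‖² ≤ ⟪Ax,x⟫` for all `x`,
  `0 ≤ ε` ⇒ `β Ex(c) ≤ ε |c|²` (`λ_min(A)(r − 1) ≤ ε`; from `β⟪A d, d⟫ ≤ ‖A d‖² = ε²‖u‖²`);
* `finiteRank_downdate_excess_rayleigh_two_sided` — both: `β Ex(c) ≤ ε |c|² ≤ Λ Ex(c)`.

Equivalently (matrix form): `c` is a fixed vector of `M_ε = Vᵀ(A + ε)⁻¹V` (secular system) and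
`(β/(β+ε)) A⁻¹ ≤ (A + ε)⁻¹ ≤ (Λ/(Λ+ε)) A⁻¹` for `β ≤ A ≤ Λ`, so `1 = ĉᵀM_εĉ` is squeezed between
`rβ/(β+ε)` and `rΛ/(Λ+ε)`. [Golub–Van Loan, *Matrix Computations* 4th ed., Thm 8.4.3 (`m = 1`);
Arbenz–Golub 1988 (block secular equation); Horn–Johnson Thm 7.7.7.]
-/

noncomputable section

open scoped InnerProductSpace RealInnerProductSpace BigOperators

namespace Literature.Analysis.InnerProduct

variable {E : Type*} [NormedAddCommGroup E] [InnerProductSpace ℝ E]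
variable {ι : Type*} [Fintype ι]

/-- **Arrival law, Rayleigh–Cauchy–Schwarz form**: for ANY eigenpair `A u − ∑ᵢ ⟪vᵢ,u⟫ vᵢ = −ε u` of
the downdate of a symmetric nonnegative `A` and witnesses `A zⱼ = vⱼ`,
`ε ⟪u,u⟫ · ∑ᵢ ⟪vᵢ,u⟫² ≤ (∑ᵢ∑ⱼ ⟪vᵢ,u⟫⟪vⱼ,u⟫⟪vᵢ,zⱼ⟫ − ∑ᵢ ⟪vᵢ,u⟫²) · ⟪A u, u⟫`, i.e.
`ε‖u‖²|c|² ≤ Ex(c)⟪Au,u⟫` (`ε ≤ (r − 1)⟪Au,u⟫/‖u‖²`, `r = cᵀMc/|c|²`); one driver: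
`SecularExcess`'s `ε‖u‖² ≤ (vᵀA⁻¹v − 1)⟪Au,u⟫`. [cite: ArbenzGolub1988, block secular equation] -/
theorem finiteRank_downdate_eig_mul_sq_moment_le_excess_mul_form (A : E →ₗ[ℝ] E)
    (hsym : ∀ x y : E, ⟪A x, y⟫_ℝ = ⟪x, A y⟫_ℝ) (hpos : ∀ x : E, 0 ≤ ⟪A x, x⟫_ℝ)
    {v z : ι → E} {u : E} {ε : ℝ}
    (hu : A u - ∑ i, ⟪v i, u⟫_ℝ • v i = -(ε • u)) (hz : ∀ i, A (z i) = v i) :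
    ε * ⟪u, u⟫_ℝ * ∑ i, ⟪v i, u⟫_ℝ ^ 2
      ≤ (∑ i, ∑ j, ⟪v i, u⟫_ℝ * ⟪v j, u⟫_ℝ * ⟪v i, z j⟫_ℝ - ∑ i, ⟪v i, u⟫_ℝ ^ 2)
          * ⟪A u, u⟫_ℝ := by
  classical
  rw [finiteRank_downdate_excess_eq A hsym hu hz, finiteRank_downdate_sum_sq_moment_eq A hu]
  set w : E := ∑ j, ⟪v j, u⟫_ℝ • z j with hw
  have hd := finiteRank_downdate_apply_witnessSum_sub A hu hz
  rw [← hw] at hd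
  set d : E := w - u with hd_def
  have hAdu : ⟪A d, u⟫_ℝ = ε * ⟪u, u⟫_ℝ := by rw [hd, real_inner_smul_left]
  have hAdd : ⟪A d, d⟫_ℝ = ε * ⟪u, d⟫_ℝ := by rw [hd, real_inner_smul_left]
  have huw : ⟪u, w⟫_ℝ = ⟪u, u⟫_ℝ + ⟪u, d⟫_ℝ := by
    rw [hd_def, inner_sub_right]; ring
  have hcs := sq_inner_le_of_nonneg_form A hsym ⊤ (fun y _ => hpos y)
    (Submodule.mem_top : d ∈ ⊤) (Submodule.mem_top : u ∈ ⊤)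
  rw [hAdu, hAdd] at hcs
  rw [huw]
  nlinarith [hcs, hpos u]

/-- **Upper Rayleigh bound**: if moreover `⟪A x, x⟫ ≤ Λ ⟪x, x⟫` for all `x` (`A ≤ Λ`), `0 ≤ ε` and
`u ≠ 0`, then `ε ∑ᵢ ⟪vᵢ,u⟫² ≤ Λ (∑ᵢ∑ⱼ ⟪vᵢ,u⟫⟪vⱼ,u⟫⟪vᵢ,zⱼ⟫ − ∑ᵢ ⟪vᵢ,u⟫²)`, i.e. `ε|c|² ≤ ‖A‖ Ex(c)`,
`ε ≤ ‖A‖(r − 1)`; one driver: `SecularExcess`'s `ε ≤ ‖A‖(vᵀA⁻¹v − 1)`.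
[cite: GolubVanLoan2013, Thm 8.4.3] -/
theorem finiteRank_downdate_eig_mul_sq_moment_le_mul_excess (A : E →ₗ[ℝ] E)
    (hsym : ∀ x y : E, ⟪A x, y⟫_ℝ = ⟪x, A y⟫_ℝ) (hpos : ∀ x : E, 0 ≤ ⟪A x, x⟫_ℝ)
    {v z : ι → E} {u : E} {ε Λ : ℝ} (hε : 0 ≤ ε) (hu0 : u ≠ 0)
    (hu : A u - ∑ i, ⟪v i, u⟫_ℝ • v i = -(ε • u)) (hz : ∀ i, A (z i) = v i)
    (hΛ : ∀ x : E, ⟪A x, x⟫_ℝ ≤ Λ * ⟪x, x⟫_ℝ) :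
    ε * ∑ i, ⟪v i, u⟫_ℝ ^ 2
      ≤ Λ * (∑ i, ∑ j, ⟪v i, u⟫_ℝ * ⟪v j, u⟫_ℝ * ⟪v i, z j⟫_ℝ - ∑ i, ⟪v i, u⟫_ℝ ^ 2) := by
  have h1 := finiteRank_downdate_eig_mul_sq_moment_le_excess_mul_form A hsym hpos hu hz
  have hEx := finiteRank_downdate_excess_nonneg A hsym hpos hε hu hz
  have huu : 0 < ⟪u, u⟫_ℝ := real_inner_self_pos.mpr hu0
  have h2 := mul_le_mul_of_nonneg_left (hΛ u) hEx
  have h3 : ⟪u, u⟫_ℝ * (ε * ∑ i, ⟪v i, u⟫_ℝ ^ 2)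
      ≤ ⟪u, u⟫_ℝ * (Λ * (∑ i, ∑ j, ⟪v i, u⟫_ℝ * ⟪v j, u⟫_ℝ * ⟪v i, z j⟫_ℝ
          - ∑ i, ⟪v i, u⟫_ℝ ^ 2)) := by
    nlinarith [h1, h2]
  exact le_of_mul_le_mul_left h3 huu

/-- **Coercive lower Rayleigh bound**: if moreover `0 ≤ β`, `β ⟪x, x⟫ ≤ ⟪A x, x⟫` for all `x`
(`A ≥ β`) and `0 ≤ ε`, then `β (∑ᵢ∑ⱼ ⟪vᵢ,u⟫⟪vⱼ,u⟫⟪vᵢ,zⱼ⟫ − ∑ᵢ ⟪vᵢ,u⟫²) ≤ ε ∑ᵢ ⟪vᵢ,u⟫²`, i.e.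
`λ_min(A) Ex(c) ≤ ε|c|²`, `λ_min(A)(r − 1) ≤ ε`: a negative eigenvalue of the downdate is at least
the remainder's bottom scale times the Rayleigh excess of the capacitance matrix at its moment vector
(`β ⟪A d, d⟫ ≤ ‖A d‖² = ε²‖u‖²` for `d = Zc − u`); one driver: `SecularExcess`'s
`λ_min(A)(vᵀA⁻¹v − 1) ≤ ε`. [cite: GolubVanLoan2013, Thm 8.4.3] -/
theorem finiteRank_downdate_mul_excess_le_eig_mul_sq_moment (A : E →ₗ[ℝ] E)
    (hsym : ∀ x y : E, ⟪A x, y⟫_ℝ = ⟪x, A y⟫_ℝ) {v z : ι → E} {u : E} {ε β : ℝ} (hε : 0 ≤ ε)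
    (hu : A u - ∑ i, ⟪v i, u⟫_ℝ • v i = -(ε • u)) (hz : ∀ i, A (z i) = v i)
    (hβ0 : 0 ≤ β) (hβ : ∀ x : E, β * ⟪x, x⟫_ℝ ≤ ⟪A x, x⟫_ℝ) :
    β * (∑ i, ∑ j, ⟪v i, u⟫_ℝ * ⟪v j, u⟫_ℝ * ⟪v i, z j⟫_ℝ - ∑ i, ⟪v i, u⟫_ℝ ^ 2)
      ≤ ε * ∑ i, ⟪v i, u⟫_ℝ ^ 2 := by
  classical
  rw [finiteRank_downdate_excess_eq A hsym hu hz, finiteRank_downdate_sum_sq_moment_eq A hu]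
  set w : E := ∑ j, ⟪v j, u⟫_ℝ • z j with hw
  have hd := finiteRank_downdate_apply_witnessSum_sub A hu hz
  rw [← hw] at hd
  set d : E := w - u with hd_def
  have hAdd : ⟪A d, d⟫_ℝ = ε * ⟪u, d⟫_ℝ := by rw [hd, real_inner_smul_left]
  have hAdAd : ⟪A d, A d⟫_ℝ = ε * ε * ⟪u, u⟫_ℝ := by
    rw [hd, real_inner_smul_left, real_inner_smul_right]; ring
  have huw : ⟪u, w⟫_ℝ = ⟪u, u⟫_ℝ + ⟪u, d⟫_ℝ := by
    rw [hd_def, inner_sub_right]; ring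
  have hkey : β * ⟪A d, d⟫_ℝ ≤ ⟪A d, A d⟫_ℝ := by
    have h1 : 0 ≤ ⟪A d - β • d, A d - β • d⟫_ℝ := real_inner_self_nonneg
    simp only [inner_sub_left, inner_sub_right, real_inner_smul_left, real_inner_smul_right] at h1
    have h2 : β * (β * ⟪d, d⟫_ℝ) ≤ β * ⟪A d, d⟫_ℝ := mul_le_mul_of_nonneg_left (hβ d) hβ0
    have h3 : ⟪d, A d⟫_ℝ = ⟪A d, d⟫_ℝ := (hsym d d).symm
    nlinarith [h1, h2, h3]
  rw [hAdd, hAdAd] at hkey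
  have h4 : ε * (β * ⟪u, u⟫_ℝ) ≤ ε * ⟪A u, u⟫_ℝ := mul_le_mul_of_nonneg_left (hβ u) hε
  rw [huw]
  nlinarith [hkey, h4]

/-- **Two-sided Rayleigh arrival law** (`β ≤ A ≤ Λ`, `0 ≤ ε`, `u ≠ 0`):
`β Ex(c) ≤ ε |c|² ≤ Λ Ex(c)` — with `r = cᵀMc/|c|²`, `λ_min(A)(r − 1) ≤ ε ≤ ‖A‖(r − 1)`: a negative
eigenvalue `−ε` of `A − ∑ᵢ|vᵢ⟩⟨vᵢ|` is the Rayleigh excess of the capacitance matrix `VᵀA⁻¹V` at its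
own moment vector times a scale of the remainder between its bottom and its top.
[cite: GolubVanLoan2013, Thm 8.4.3; ArbenzGolub1988, block secular equation] -/
theorem finiteRank_downdate_excess_rayleigh_two_sided (A : E →ₗ[ℝ] E)
    (hsym : ∀ x y : E, ⟪A x, y⟫_ℝ = ⟪x, A y⟫_ℝ) (hpos : ∀ x : E, 0 ≤ ⟪A x, x⟫_ℝ)
    {v z : ι → E} {u : E} {ε β Λ : ℝ} (hε : 0 ≤ ε) (hu0 : u ≠ 0)
    (hu : A u - ∑ i, ⟪v i, u⟫_ℝ • v i = -(ε • u)) (hz : ∀ i, A (z i) = v i)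
    (hβ0 : 0 ≤ β) (hβ : ∀ x : E, β * ⟪x, x⟫_ℝ ≤ ⟪A x, x⟫_ℝ)
    (hΛ : ∀ x : E, ⟪A x, x⟫_ℝ ≤ Λ * ⟪x, x⟫_ℝ) :
    β * (∑ i, ∑ j, ⟪v i, u⟫_ℝ * ⟪v j, u⟫_ℝ * ⟪v i, z j⟫_ℝ - ∑ i, ⟪v i, u⟫_ℝ ^ 2)
        ≤ ε * ∑ i, ⟪v i, u⟫_ℝ ^ 2 ∧
      ε * ∑ i, ⟪v i, u⟫_ℝ ^ 2
        ≤ Λ * (∑ i, ∑ j, ⟪v i, u⟫_ℝ * ⟪v j, u⟫_ℝ * ⟪v i, z j⟫_ℝ - ∑ i, ⟪v i, u⟫_ℝ ^ 2) :=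
  ⟨finiteRank_downdate_mul_excess_le_eig_mul_sq_moment A hsym hε hu hz hβ0 hβ,
    finiteRank_downdate_eig_mul_sq_moment_le_mul_excess A hsym hpos hε hu0 hu hz hΛ⟩

end Literature.Analysis.InnerProduct
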